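import Summits.ResolutionOfSingularities.ResolutionOfSingularities.Theorems.FrobeniusClosingSteerEtaleWindowWords
import Literature.AlgebraicGeometry.Resolution.RsopMonomialIdeals
import HarnessLib

/-!
# [OURS · L0 W4.1] W-NRA-B, step (P4) TYPED: the word `NonRationalWindow.BDatumDescentTwoN` — DESCENT of the binary on-axis datum along one
# level of the étale window lift (res-L0-w41-plan-1 RULING 316 (c); hH2′ / hNRAB; `--supports … --as helper`)

HONEST FRAMING. OURS word (HIRONAKA-L librarian res-D-lib-1 gen 8; READ + PLAN STATUS 21:52:17Z). The EtaleLift route to W-NRA-B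
(`NonRationalWindow.NonRationalBWindowsTwoN`): (P2) lift the odd-satellite 3-window to a residually RATIONAL window (`EtaleLift.exists_rational_window_lift`),
(P3) run the window kernel F3 `BinaryResidue.binaryResidue_of_oddSatellite` UPSTAIRS — its output is a pair `σ′, τ′ ∈ (φ₀ u)` forming part of a regular
system of parameters of `S′₀` with `φ₀ (f₀ − G₀²) ∈ (σ′, τ′)^d + 𝔪′^(d+1)` —, (P4) DESCEND that output to `S₀`. This file TYPES (P4) as ONE word, on the
data of ONE level of the lift (`EtaleLift.LevelLift S₀ S′₀ φ₀ θ`) plus the finite SEPARABLE residue extension it comes with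
(`EtaleLift.isSeparable_residueField_localization_ker_lift`): «if the initial form of `F ∈ S₀` becomes binary inside the hyperplane `(u)` after the
residually separable unramified faithfully flat local extension `φ₀`, it is binary inside `(u)` already over `S₀`».
WHY IT SHOULD HOLD (idea-grade, for res-idea / tri seats): `𝔪^d/𝔪^(d+1) = Sym^d(𝔪/𝔪²)` for a regular local ring, and `𝔪′/𝔪′² = (𝔪/𝔪²) ⊗_κ κ′` (unramified,
flat); for a degree-`d` form `F̄` over `κ` the smallest subspace `W_min` with `F̄ ∈ Sym^d(W_min)` («essential variables») exists over any field
(`κ[W₁] ∩ κ[W₂] = κ[W₁ ∩ W₂]`) and is invariant under SEPARABLE base change (Galois descent of the `Gal`-stable subspace `W_min(F̄ ⊗ κ″)` over a Galois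
closure `κ″ ⊇ κ′ ⊇ κ`); so `dim_κ W_min(F̄) ≤ 2` with `W_min ⊆ Ū`, pad to a plane `W ⊆ Ū`, lift a basis to `σ, τ ∈ (u)`. It FAILS for inseparable
extensions (`x² + a·y²`, `a ∉ κ²`, becomes the square of ONE linear form over `κ(√a)`), which is why the word carries the separability of `κ(S′₀)/κ(S₀)`
— automatic for the étale lift; at ODD `d` (the consumers' case) the inseparable failure persists (res-L0-w41-tri-1 TRIAGE v6.78 (A)): over `κ′ = κ(√a, √b)`,
`[κ′ : κ] = 4`, the cubic `F̄ = ū₀·(ū₀² + a·ū₁² + b·ū₂²)` is `ū₀·ℓ²` upstairs (binary inside `ū ⊗ κ′`) but has `W_min = ū` (3-dimensional) downstairs.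
Size of a proof: M–L (symmetric powers of the cotangent space of a regular local ring + Galois descent of a subspace).
Nothing here is a statement of H. Hironaka's manuscript [Hironaka2017]. AI-written; AI review is weaker than expert review. Definitions only. [folklore]
-/

set_option linter.dupNamespace false

namespace Summit.ResolutionOfSingularities.ResolutionOfSingularities.Theorems.SwitchingDichotomy.NonRationalWindow

open IsLocalRing Literature.AlgebraicGeometry.Resolution
open Summit.ResolutionOfSingularities.ResolutionOfSingularities.Theorems.SwitchingDichotomy.EtaleLift

/-- **W-NRA-B (P4) · `BDatumDescentTwoN` — descent of the binary on-axis datum along one level of the étale window lift.** For a regular local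
`S₀ ⊆ L` of dimension `4` with `𝔪_{S₀} = (x, u₁, u₂, u₃)`, a level `φ₀ : S₀ → S′₀ ⊆ L′` of the lift (`EtaleLift.LevelLift`: local, UNRAMIFIED, `φ₀⁻¹(I S′₀) = I`,
regularity and dimension transfer) whose residue extension `κ(S′₀)/κ(S₀)` is SEPARABLE, an element `F ∈ S₀` and a degree `d`: if UPSTAIRS there are
`σ′, τ′ ∈ (φ₀ u₁, φ₀ u₂, φ₀ u₃)`, part of a regular system of parameters of `S′₀`, with `φ₀ F ∈ (σ′, τ′)^d + 𝔪_{S′₀}^(d+1)` (the output of F3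
`BinaryResidue.binaryResidue_of_oddSatellite` run upstairs), then DOWNSTAIRS there are `σ, τ ∈ (u₁, u₂, u₃)`, part of a regular system of parameters
of `S₀`, with `F ∈ (σ, τ)^d + 𝔪_{S₀}^(d+1)`. OPEN (idea-grade route: essential variables of the initial form + Galois descent; see the module docstring).
[invented: ours] -/
def BDatumDescentTwoN : Prop :=
  ∀ (L L' : Type) [Field L] [Field L'] (S₀ : Subring L) (S₀' : Subring L') [IsLocalRing S₀] [IsLocalRing S₀']
    (φ₀ : S₀ →+* S₀') (θ : L'), LevelLift S₀ S₀' φ₀ θ → IsRegularLocalRing S₀ → ringKrullDim S₀ = (4 : ℕ) →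
    -- the residue extension of the level is separable (read through Mathlib's residue-field algebra of the local map `φ₀`)
    (∀ _ : IsLocalHom φ₀, letI := φ₀.toAlgebra
      haveI : IsLocalHom (algebraMap S₀ S₀') := ‹IsLocalHom φ₀›
      Algebra.IsSeparable (ResidueField S₀) (ResidueField S₀')) →
    ∀ (x : S₀) (u : Fin 3 → S₀), Ideal.span (insert x (Set.range u)) = maximalIdeal S₀ →
    ∀ (F : S₀) (d : ℕ),
    (∃ σ' τ' : S₀', σ' ∈ Ideal.span (Set.range fun i => φ₀ (u i)) ∧ τ' ∈ Ideal.span (Set.range fun i => φ₀ (u i)) ∧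
      IsRsopPart ![σ', τ'] ∧ φ₀ F ∈ Ideal.span {σ', τ'} ^ d ⊔ maximalIdeal S₀' ^ (d + 1)) →
    ∃ σ τ : S₀, σ ∈ Ideal.span (Set.range u) ∧ τ ∈ Ideal.span (Set.range u) ∧
      IsRsopPart ![σ, τ] ∧ F ∈ Ideal.span {σ, τ} ^ d ⊔ maximalIdeal S₀ ^ (d + 1)

end Summit.ResolutionOfSingularities.ResolutionOfSingularities.Theorems.SwitchingDichotomy.NonRationalWindow
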